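import Mathlib
import Summits.ResolutionOfSingularities.ResolutionOfSingularities.Theorems.WildQuotientsWildQuotientResolutionJordanFourTwistedChart
import Summits.ResolutionOfSingularities.ResolutionOfSingularities.Theorems.WildQuotientsWildQuotientResolutionInitialFormInjective
import Summits.ResolutionOfSingularities.ResolutionOfSingularities.Theorems.WildQuotientsWildQuotientResolutionToricExitRootSubstInjective

/-!
# V4U piece T — the twisted root chart `ψ_T` is injective (initial-form criterion)

(crux stmt-ResolutionOfSingularities-15640 `WildQuotients.WildQuotientResolution`, line `Sketch`,
sector `|G| = p`; programme V4U of `L/w45c/CHAIN.md` v6 §4 row stub-1 (T1 «injectivity») and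
`L/w45c/V4U-DESIGN.md` §3/§6 («`twistedChart_injective` (via T-v … or algebraic independence of the
four images)»). [OURS · L1 W4.5c] — NOT a statement of any manuscript; replaces the role of no
printed item. Prover res-L1-w45c-stub-1.)

GENERIC CRITERION (`aeval_injective_of_initialForms`, file `…InitialFormInjective`): let
`g, g₀ : ι → R[τ]`, weights `w₁ : ι → ℕ`, `w₂ : τ → ℕ` with `g₀ i` `w₂`-homogeneous of degree `w₁ i`
and every monomial of `g i − g₀ i` of `w₂`-weight `> w₁ i` («`g₀ i` is the initial form of `g i`»).
If `aeval g₀` is injective, so is `aeval g`: for `F ≠ 0` with minimal `w₁`-weight `m` on its support,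
the `w₂`-weight-`m` component of `aeval g F` is `aeval g₀ (F_m) ≠ 0`.
INSTANCE (`twistedChart_injective`, `2, 3 ∈ kˣ`): with `w₂(s, A, ξ, η) = (3, 2, 2, 1)`
(`s = X b`, `A = X a`, `ξ = X c`, `η = X d`, passengers `0`) the initial forms of
`ψ_T(x_a), ψ_T(x_b), ψ_T(x_c), ψ_T(x_d)` are `s³A, s², sξ, −η/6` (weights `11, 6, 5, 1`), a monomial
map with injective exponent matrix — injective by stub-2's `ToricExit.monomialTwist_injective`
(p489384) after the unit rescaling `x_d ↦ −6 x_d`.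
-/

-- single-problem summit: the doubled namespace component `ResolutionOfSingularities` is forced
set_option linter.dupNamespace false

noncomputable section

open MvPolynomial

namespace Summit.ResolutionOfSingularities.ResolutionOfSingularities.Theorems.WildQuotientResolution.JordanFour


section TwistedChart

/-! ### The twisted chart is injective -/

variable (k : Type) [Field k] (n : ℕ) (a b c d : Fin n)
  (hab : a ≠ b) (hac : a ≠ c) (had : a ≠ d) (hbc : b ≠ c) (hbd : b ≠ d) (hcd : c ≠ d)

include hab hac had hbc hbd hcd in
/-- **The initial monomial map of `ψ_T` is injective**: `x_a ↦ s³A`, `x_b ↦ s²`, `x_c ↦ sξ`,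
`x_d ↦ −η/6`, `x_i ↦ x_i` — a root substitution (`ToricExit.monomialTwist_injective`, pivot `b`,
`d = 2`, twists `e_a = 3`, `e_c = 1`) precomposed with the unit rescaling `x_d ↦ −x_d/6`.
[OURS · L1 W4.5c] -/
theorem aeval_initial_injective (h2 : (2 : k) ≠ 0) (h3 : (3 : k) ≠ 0) :
    Function.Injective (aeval (fun i : Fin n =>
      if i = a then X b ^ 3 * X a else if i = b then X b ^ 2 else if i = c then X b * X c
      else if i = d then C (-6⁻¹ : k) * X d else (X i : MvPolynomial (Fin n) k)) :
        MvPolynomial (Fin n) k →ₐ[k] MvPolynomial (Fin n) k) := by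
  classical
  have h6 : (6 : k) ≠ 0 := by
    rw [show (6 : k) = 2 * 3 by norm_num]
    exact mul_ne_zero h2 h3
  -- the root substitution `μ` and the rescaling `sc` (with inverse `sc'`)
  let e : Fin n → ℕ := fun s => if s = a then 3 else if s = c then 1 else 0
  let μ : MvPolynomial (Fin n) k →ₐ[k] MvPolynomial (Fin n) k :=
    aeval fun s => if s = b then X b ^ 2 else X s * X b ^ e s
  let sc : MvPolynomial (Fin n) k →ₐ[k] MvPolynomial (Fin n) k :=
    aeval fun s => if s = d then C (-6⁻¹ : k) * X d else X s
  let sc' : MvPolynomial (Fin n) k →ₐ[k] MvPolynomial (Fin n) k :=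
    aeval fun s => if s = d then C (-6 : k) * X d else X s
  have hμa : μ (X a) = X a * X b ^ 3 := by simp [μ, e, hab]
  have hμb : μ (X b) = X b ^ 2 := by simp [μ]
  have hμc : μ (X c) = X c * X b := by simp [μ, e, Ne.symm hbc, Ne.symm hac]
  have hμi : ∀ i, i ≠ a → i ≠ b → i ≠ c → μ (X i) = X i := by
    intro i hia hib hic; simp [μ, e, hia, hib, hic]
  have hμC : ∀ r : k, μ (C r) = C r := fun r => by
    rw [MvPolynomial.algHom_C, MvPolynomial.algebraMap_eq]
  have hscd : sc (X d) = C (-6⁻¹ : k) * X d := by simp [sc]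
  have hsci : ∀ i, i ≠ d → sc (X i) = X i := by intro i hid; simp [sc, hid]
  have hsc'd : sc' (X d) = C (-6 : k) * X d := by simp [sc']
  have hsc'i : ∀ i, i ≠ d → sc' (X i) = X i := by intro i hid; simp [sc', hid]
  have hsc'C : ∀ r : k, sc' (C r) = C r := fun r => by
    rw [MvPolynomial.algHom_C, MvPolynomial.algebraMap_eq]
  have hμ : Function.Injective μ := ToricExit.monomialTwist_injective k n b 2 two_pos e
  have hsc : Function.Injective sc := by
    have hinv : ∀ f, sc' (sc f) = f := by
      intro f
      have key : sc'.comp sc = AlgHom.id k _ := by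
        refine MvPolynomial.algHom_ext fun i => ?_
        change sc' (sc (X i)) = X i
        by_cases hid : i = d
        · rw [hid, hscd, map_mul, hsc'C, hsc'd, ← mul_assoc, ← map_mul,
            show (-6⁻¹ : k) * -6 = 1 by rw [neg_mul_neg, inv_mul_cancel₀ h6], map_one, one_mul]
        · rw [hsci i hid, hsc'i i hid]
      exact congrArg (fun φ : MvPolynomial (Fin n) k →ₐ[k] MvPolynomial (Fin n) k => φ f) key
    exact Function.LeftInverse.injective hinv
  have hcomp : (aeval (fun i : Fin n =>
      if i = a then X b ^ 3 * X a else if i = b then X b ^ 2 else if i = c then X b * X c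
      else if i = d then C (-6⁻¹ : k) * X d else (X i : MvPolynomial (Fin n) k)) :
        MvPolynomial (Fin n) k →ₐ[k] MvPolynomial (Fin n) k) = μ.comp sc := by
    refine MvPolynomial.algHom_ext fun i => ?_
    rw [aeval_X, AlgHom.comp_apply]
    by_cases hia : i = a
    · rw [hia, if_pos rfl, hsci a had, hμa]; ring
    by_cases hib : i = b
    · rw [hib, if_neg (Ne.symm hab), if_pos rfl, hsci b hbd, hμb]
    by_cases hic : i = c
    · rw [hic, if_neg (Ne.symm hac), if_neg (Ne.symm hbc), if_pos rfl, hsci c hcd, hμc]; ring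
    by_cases hid : i = d
    · rw [hid, if_neg (Ne.symm had), if_neg (Ne.symm hbd), if_neg (Ne.symm hcd), if_pos rfl, hscd,
        map_mul, hμC, hμi d (Ne.symm had) (Ne.symm hbd) (Ne.symm hcd)]
    · rw [if_neg hia, if_neg hib, if_neg hic, if_neg hid, hsci i hid, hμi i hia hib hic]
  rw [hcomp]
  exact hμ.comp hsc

include hab hac had hbc hbd hcd in
/-- **`ψ_T` is injective** (`2, 3 ∈ kˣ`): initial-form criterion with target weights
`(s, A, ξ, η) = (3, 2, 2, 1)`, source weights `(x_a, x_b, x_c, x_d) = (11, 6, 5, 1)`, passengers `0`.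
[OURS · L1 W4.5c] -/
theorem twistedChart_injective (h2 : (2 : k) ≠ 0) (h3 : (3 : k) ≠ 0) :
    Function.Injective (twistedChart k n a b c d) := by
  classical
  -- weights
  let w₂ : Fin n → ℕ := fun i => if i = b then 3 else if i = a then 2 else if i = c then 2
    else if i = d then 1 else 0
  let w₁ : Fin n → ℕ := fun i => if i = a then 11 else if i = b then 6 else if i = c then 5
    else if i = d then 1 else 0
  have hwb : w₂ b = 3 := by simp [w₂]
  have hwa : w₂ a = 2 := by simp [w₂, hab]
  have hwc : w₂ c = 2 := by simp [w₂, Ne.symm hbc, Ne.symm hac]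
  have hwd : w₂ d = 1 := by simp [w₂, Ne.symm hbd, Ne.symm had, Ne.symm hcd]
  have hw0 : ∀ i, i ≠ a → i ≠ b → i ≠ c → i ≠ d → w₂ i = 0 := by
    intro i hia hib hic hid; simp [w₂, hia, hib, hic, hid]
  have hXa : IsWeightedHomogeneous w₂ (X a : MvPolynomial (Fin n) k) 2 := hwa ▸ isWeightedHomogeneous_X k w₂ a
  have hXb : IsWeightedHomogeneous w₂ (X b : MvPolynomial (Fin n) k) 3 := hwb ▸ isWeightedHomogeneous_X k w₂ b
  have hXc : IsWeightedHomogeneous w₂ (X c : MvPolynomial (Fin n) k) 2 := hwc ▸ isWeightedHomogeneous_X k w₂ c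
  have hXd : IsWeightedHomogeneous w₂ (X d : MvPolynomial (Fin n) k) 1 := hwd ▸ isWeightedHomogeneous_X k w₂ d
  -- initial forms
  let g₀ : Fin n → MvPolynomial (Fin n) k := fun i =>
    if i = a then X b ^ 3 * X a else if i = b then X b ^ 2 else if i = c then X b * X c
    else if i = d then C (-6⁻¹ : k) * X d else X i
  have hg₀a : g₀ a = X b ^ 3 * X a := by simp [g₀]
  have hg₀b : g₀ b = X b ^ 2 := by simp [g₀, Ne.symm hab]
  have hg₀c : g₀ c = X b * X c := by simp [g₀, Ne.symm hac, Ne.symm hbc]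
  have hg₀d : g₀ d = C (-6⁻¹ : k) * X d := by simp [g₀, Ne.symm had, Ne.symm hbd, Ne.symm hcd]
  have hg₀i : ∀ i, i ≠ a → i ≠ b → i ≠ c → i ≠ d → g₀ i = X i := by
    intro i hia hib hic hid; simp [g₀, hia, hib, hic, hid]
  have h₀ : ∀ i, IsWeightedHomogeneous w₂ (g₀ i) (w₁ i) := by
    intro i
    by_cases hia : i = a
    · subst hia
      rw [hg₀a, show w₁ i = 11 by simp [w₁]]
      exact (hXb.pow 3).mul hXa
    by_cases hib : i = b
    · subst hib
      rw [hg₀b, show w₁ i = 6 by simp [w₁, hia]]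
      exact hXb.pow 2
    by_cases hic : i = c
    · subst hic
      rw [hg₀c, show w₁ i = 5 by simp [w₁, hia, hib]]
      exact hXb.mul hXc
    by_cases hid : i = d
    · subst hid
      rw [hg₀d, show w₁ i = 1 by simp [w₁, hia, hib, hic]]
      exact hXd.C_mul _
    · rw [hg₀i i hia hib hic hid, show w₁ i = 0 by simp [w₁, hia, hib, hic, hid]]
      have h := isWeightedHomogeneous_X k w₂ i
      rwa [hw0 i hia hib hic hid] at h
  -- remainders
  have hr : ∀ i d', coeff d' (twistedChartFun k n a b c d i - g₀ i) ≠ 0 →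
      w₁ i + 1 ≤ Finsupp.weight w₂ d' := by
    intro i
    by_cases hia : i = a
    · subst hia
      have e0 : twistedChartFun k n i b c d i - g₀ i = 0 := by
        rw [hg₀a]; simp [twistedChartFun]
      intro d' hd'; rw [e0, coeff_zero] at hd'; exact absurd rfl hd'
    by_cases hib : i = b
    · subst hib
      have e0 : twistedChartFun k n a i c d i - g₀ i = X i ^ 2 * X a * X c * 1 := by
        rw [hg₀b]; simp [twistedChartFun, Ne.symm hab]; ring
      rw [e0, show w₁ i + 1 = 7 by simp [w₁, hia]]
      exact lb_mul_of_isWeightedHomogeneous_left w₂ (((hXb.pow 2).mul hXa).mul hXc) (by norm_num) _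
    by_cases hic : i = c
    · subst hic
      have e0 : twistedChartFun k n a b i d i - g₀ i =
          X b ^ 2 * (1 - C (2⁻¹ : k) * X a * X i) + X b * X i ^ 2 * (C (2⁻¹ : k) * X a) +
            X a * X b * X d * (-C (2⁻¹ : k)) := by
        rw [hg₀c]; simp [twistedChartFun, twistedP, Ne.symm hac, Ne.symm hbc]; ring
      rw [e0, show w₁ i + 1 = 6 by simp [w₁, hia, hib]]
      refine lb_add w₂ (lb_add w₂ ?_ ?_) ?_
      · exact lb_mul_of_isWeightedHomogeneous_left w₂ (hXb.pow 2) (by norm_num) _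
      · exact lb_mul_of_isWeightedHomogeneous_left w₂ (hXb.mul (hXc.pow 2)) (by norm_num) _
      · exact lb_mul_of_isWeightedHomogeneous_left w₂ ((hXa.mul hXb).mul hXd) (by norm_num) _
    by_cases hid : i = d
    · subst hid
      have e0 : twistedChartFun k n a b c i i - g₀ i =
          X c * (C (2⁻¹ : k) * X c + C (2⁻¹ : k) * X b +
            C (6⁻¹ : k) * X a * (X c ^ 2 - 3 * (X b * X c) - 3 * X i + 2 * X b ^ 2)) +
            X b ^ 2 * C (3⁻¹ : k) := by
        rw [hg₀d]; simp [twistedChartFun, Ne.symm had, Ne.symm hbd, Ne.symm hcd]; ring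
      rw [e0, show w₁ i + 1 = 2 by simp [w₁, hia, hib, hic]]
      refine lb_add w₂ ?_ ?_
      · exact lb_mul_of_isWeightedHomogeneous_left w₂ hXc (by norm_num) _
      · exact lb_mul_of_isWeightedHomogeneous_left w₂ (hXb.pow 2) (by norm_num) _
    · have e0 : twistedChartFun k n a b c d i - g₀ i = 0 := by
        rw [hg₀i i hia hib hic hid]; simp [twistedChartFun, hia, hib, hic, hid]
      intro d' hd'; rw [e0, coeff_zero] at hd'; exact absurd rfl hd'
  exact aeval_injective_of_initialForms w₁ w₂ (twistedChartFun k n a b c d) g₀ h₀ hr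
    (aeval_initial_injective k n a b c d hab hac had hbc hbd hcd h2 h3)

end TwistedChart

end Summit.ResolutionOfSingularities.ResolutionOfSingularities.Theorems.WildQuotientResolution.JordanFour

end
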